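import Mathlib
import Summits.Parity.GeneralizedHardyLittlewood.Theorems.FordMaynardSieveConst01651SieveConst01651TypeIICoeffs
import Summits.Parity.GeneralizedHardyLittlewood.Theorems.FordMaynardSieveConst01651SieveConst01651TupleSplit

/-!
# Route `FordMaynardSieveConst01651`, target `SieveConst01651` (stmt-Parity-19185), line `sieve_decomposition`:
# helpers towards `stub_typeIIRegion` — the Type-II end of Ford–Maynard's Proposition 7.22, assembled

Ford–Maynard, arXiv:2407.14368v1, proof of Proposition 7.22, display (eq:sieve-final) and the paragraph after it
(p. 43): for every non-empty `E ⊆ [N]` and `1`-bounded `υ₁, …, υ_N`,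
`∑_{n = n₁⋯n_N ∼ x, ∏_{e∈E} n_e ∈ ((x/2)^θ, x^{θ+ν}]} w_n υ₁(n₁)⋯υ_N(n_N) ≪ x/(log x)^{A'}`
"follows from the Type II bound (eq:TypeII) if `B` is sufficiently large": writing `n = n'n''` with
`n' = ∏_{e∈E} n_e`, the sum is `∑ Y₁(n') Y₂(n'') w_{n'n''}` with `|Y₁| ≤ τ^{|E|−1}`, `|Y₂| ≤ τ^{N−|E|−1}` (Lemma 7.7).
Here this is ONE theorem in the tree's vocabulary (`typeII_tuple_sum_bound`): hypothesis `FordMaynard.TypeII w x θ ν B`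
with `B ≥ max(|E| − 1, |Eᶜ| − 1, 0)`, conclusion the displayed bound with constant `1` and exponent `B`, the tuples
being Mathlib's `Nat.finMulAntidiag N n` and the window `x/2 < n ≤ x` the tree's `(Icc 1 ⌊x⌋₊).filter (x/2 < ·)`.
Ingredients: `sum_finMulAntidiag_split_mul` (…TupleSplit), `typeII_apply_tupleCoeff` (…TypeIICoeffs) and the
elementary window rearrangement `∑_{n ∼ x} ∑_{n'n'' = n} = ∑_{n'} ∑_{n'' : n'n'' ∼ x}` (`sum_window_divisorsAntidiagonal`).
Def-free. Nothing here proves anything about the Parity summit.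
-/

open Finset

namespace Summit.Parity.GeneralizedHardyLittlewood.FordMaynardSieveConst01651SieveConst01651

/-- **Window rearrangement**: `∑_{n ≤ X, P(n)} ∑_{(m, n'') : m n'' = n} G(m, n'') = ∑_{m ≤ X} ∑_{n'' ≤ X, m n'' ≤ X, P(m n'')} G(m, n'')`
(all indices `≥ 1`). [folklore] -/
theorem sum_window_divisorsAntidiagonal {M : Type*} [AddCommMonoid M] (X : ℕ) (P : ℕ → Prop) [DecidablePred P]
    (G : ℕ → ℕ → M) :
    ∑ n ∈ (Icc 1 X).filter P, ∑ p ∈ n.divisorsAntidiagonal, G p.1 p.2 =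
      ∑ m ∈ Icc 1 X, ∑ n'' ∈ (Icc 1 X).filter (fun n'' => m * n'' ≤ X ∧ P (m * n'')), G m n'' := by
  rw [Finset.sum_sigma', Finset.sum_sigma']
  refine Finset.sum_nbij' (fun y => ⟨y.2.1, y.2.2⟩) (fun z => ⟨z.1 * z.2, (z.1, z.2)⟩) ?_ ?_ ?_ ?_ ?_
  · rintro ⟨n, d, e⟩ hy
    rw [Finset.mem_sigma, Finset.mem_filter, Finset.mem_Icc, Nat.mem_divisorsAntidiagonal] at hy
    obtain ⟨⟨⟨h1, hX⟩, hP⟩, hde, hn⟩ := hy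
    dsimp only at hde hn ⊢
    have hd : d ≠ 0 := by rintro rfl; rw [zero_mul] at hde; exact hn hde.symm
    have he : e ≠ 0 := by rintro rfl; rw [mul_zero] at hde; exact hn hde.symm
    rw [Finset.mem_sigma, Finset.mem_Icc, Finset.mem_filter, Finset.mem_Icc]
    refine ⟨⟨Nat.one_le_iff_ne_zero.mpr hd, ?_⟩, ⟨Nat.one_le_iff_ne_zero.mpr he, ?_⟩, ?_, ?_⟩
    · calc d ≤ d * e := Nat.le_mul_of_pos_right d (Nat.pos_of_ne_zero he)
        _ ≤ X := by rw [hde]; exact hX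
    · calc e ≤ d * e := Nat.le_mul_of_pos_left e (Nat.pos_of_ne_zero hd)
        _ ≤ X := by rw [hde]; exact hX
    · rw [hde]; exact hX
    · rw [hde]; exact hP
  · rintro ⟨m, n''⟩ hz
    rw [Finset.mem_sigma] at hz
    dsimp only at hz
    rw [Finset.mem_Icc, Finset.mem_filter, Finset.mem_Icc] at hz
    obtain ⟨⟨hm1, _⟩, ⟨hn1, _⟩, hX, hP⟩ := hz
    rw [Finset.mem_sigma, Finset.mem_filter, Finset.mem_Icc, Nat.mem_divisorsAntidiagonal]
    dsimp only
    refine ⟨⟨⟨Nat.one_le_iff_ne_zero.mpr (Nat.mul_ne_zero (by omega) (by omega)), hX⟩, hP⟩, rfl,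
      Nat.mul_ne_zero (by omega) (by omega)⟩
  · rintro ⟨n, d, e⟩ hy
    rw [Finset.mem_sigma, Finset.mem_filter, Finset.mem_Icc, Nat.mem_divisorsAntidiagonal] at hy
    obtain ⟨_, hde, _⟩ := hy
    dsimp only at hde ⊢
    exact Sigma.ext hde HEq.rfl
  · rintro ⟨m, n''⟩ _
    rfl
  · rintro ⟨n, d, e⟩ _
    rfl

/-- **The Type-II end of Proposition 7.22** ((eq:sieve-final) ⇐ (II)): if `w` satisfies Ford–Maynard's Type-II bound
on `((x/2)^θ, x^{θ+ν}]` with exponent `B ≥ max(k − 1, l − 1, 0)`, `k = |E|`, `l = |Eᶜ|`, then for `1`-bounded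
`υ₁, …, υ_N`,
`|∑_{x/2 < n ≤ x} w_n ∑_{n = n₁⋯n_N, ∏_{e∈E} n_e ∈ ((x/2)^θ, x^{θ+ν}]} ∏_j υ_j(n_j)| ≤ x/(log x)^B`
(`E` enumerated increasingly by `E.orderEmbOfFin`; `x ≥ 0`).
[cite: FordMaynard2024PrimeSieves, proof of Proposition 7.22 (display (eq:sieve-final) and the concluding paragraph)] -/
theorem typeII_tuple_sum_bound {w : ℕ → ℝ} {x θ ν B : ℝ} (hx : 0 ≤ x)
    (hII : Literature.Barriers.Parity.FordMaynard.TypeII w x θ ν B) {N : ℕ} (E : Finset (Fin N)) {k l : ℕ}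
    (hk : E.card = k) (hl : Eᶜ.card = l) (υ : Fin N → ℕ → ℂ) (hυ : ∀ j a, ‖υ j a‖ ≤ 1)
    (hB0 : 0 ≤ B) (hBk : (k : ℝ) - 1 ≤ B) (hBl : (l : ℝ) - 1 ≤ B) :
    ‖∑ n ∈ (Icc 1 ⌊x⌋₊).filter (fun n : ℕ => x / 2 < (n : ℝ)), (w n : ℂ) *
        ∑ t ∈ (Nat.finMulAntidiag N n).filter (fun t =>
            (x / 2) ^ θ < ((∏ i : Fin k, t (E.orderEmbOfFin hk i) : ℕ) : ℝ) ∧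
              ((∏ i : Fin k, t (E.orderEmbOfFin hk i) : ℕ) : ℝ) ≤ x ^ (θ + ν)),
          ∏ j, υ j (t j)‖ ≤ x / Real.log x ^ B := by
  -- the range indicator `φ` and the coefficient sequences `ξ`, `κ`
  set φ : ℕ → ℂ := fun m => if (x / 2) ^ θ < (m : ℝ) ∧ (m : ℝ) ≤ x ^ (θ + ν) then 1 else 0 with hφ
  set ξ : ℕ → ℂ := fun m => ∑ a ∈ Nat.finMulAntidiag k m, ∏ i, υ (E.orderEmbOfFin hk i) (a i) with hξ
  set κ : ℕ → ℂ := fun m => ∑ b ∈ Nat.finMulAntidiag l m, ∏ i, υ (Eᶜ.orderEmbOfFin hl i) (b i) with hκ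
  -- (k1) the inner sum via the split identity
  have k1 : ∀ n : ℕ, (w n : ℂ) * ∑ t ∈ (Nat.finMulAntidiag N n).filter (fun t =>
        (x / 2) ^ θ < ((∏ i : Fin k, t (E.orderEmbOfFin hk i) : ℕ) : ℝ) ∧
          ((∏ i : Fin k, t (E.orderEmbOfFin hk i) : ℕ) : ℝ) ≤ x ^ (θ + ν)), ∏ j, υ j (t j) =
      ∑ p ∈ n.divisorsAntidiagonal, (w n : ℂ) * (φ p.1 * ξ p.1 * κ p.2) := by
    intro n
    refine Eq.trans ?_ (Finset.mul_sum _ _ _)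
    congr 1
    rw [Finset.sum_filter]
    refine Eq.trans ?_ (sum_finMulAntidiag_split_mul E hk hl φ υ n)
    refine Finset.sum_congr rfl fun t _ => ?_
    simp only [hφ]
    split_ifs <;> simp
  -- (k2)+(k3) regroup over the window
  have k3 : (∑ n ∈ (Icc 1 ⌊x⌋₊).filter (fun n : ℕ => x / 2 < (n : ℝ)),
        ∑ p ∈ n.divisorsAntidiagonal, (w n : ℂ) * (φ p.1 * ξ p.1 * κ p.2)) =
      ∑ m ∈ Icc 1 ⌊x⌋₊, ∑ n'' ∈ (Icc 1 ⌊x⌋₊).filter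
          (fun n'' => m * n'' ≤ ⌊x⌋₊ ∧ x / 2 < ((m * n'' : ℕ) : ℝ)),
        (w (m * n'') : ℂ) * (φ m * ξ m * κ n'') := by
    refine Eq.trans ?_ (sum_window_divisorsAntidiagonal ⌊x⌋₊ (fun n : ℕ => x / 2 < (n : ℝ))
      (fun m n'' => (w (m * n'') : ℂ) * (φ m * ξ m * κ n'')))
    refine Finset.sum_congr rfl fun n _ => Finset.sum_congr rfl fun p hp => ?_
    rw [(Nat.mem_divisorsAntidiagonal.mp hp).1]
  -- (k4)+(k5) the inner filter is the Type-II one; pull `φ m` out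
  have k5 : ∀ m : ℕ, (∑ n'' ∈ (Icc 1 ⌊x⌋₊).filter
          (fun n'' => m * n'' ≤ ⌊x⌋₊ ∧ x / 2 < ((m * n'' : ℕ) : ℝ)),
        (w (m * n'') : ℂ) * (φ m * ξ m * κ n'')) =
      φ m * ∑ n'' ∈ (Icc 1 ⌊x⌋₊).filter (fun n'' : ℕ => x / 2 < (m * n'' : ℝ) ∧ (m * n'' : ℝ) ≤ x),
        ξ m * κ n'' * (w (m * n'') : ℂ) := by
    intro m
    refine Eq.trans ?_ (Finset.mul_sum _ _ _).symm
    have hset : (Icc 1 ⌊x⌋₊).filter (fun n'' => m * n'' ≤ ⌊x⌋₊ ∧ x / 2 < ((m * n'' : ℕ) : ℝ)) =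
        (Icc 1 ⌊x⌋₊).filter (fun n'' : ℕ => x / 2 < (m * n'' : ℝ) ∧ (m * n'' : ℝ) ≤ x) := by
      refine Finset.filter_congr fun n'' _ => ?_
      rw [Nat.le_floor_iff hx, Nat.cast_mul, and_comm]
    rw [hset]
    refine Finset.sum_congr rfl fun n'' _ => ?_
    ring
  -- (k6)+(k7) the `m`-range
  have k7 : (∑ m ∈ Icc 1 ⌊x⌋₊, φ m *
        ∑ n'' ∈ (Icc 1 ⌊x⌋₊).filter (fun n'' : ℕ => x / 2 < (m * n'' : ℝ) ∧ (m * n'' : ℝ) ≤ x),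
          ξ m * κ n'' * (w (m * n'') : ℂ)) =
      ∑ m ∈ (Icc 1 ⌊x ^ (θ + ν)⌋₊).filter (fun m : ℕ => (x / 2) ^ θ < (m : ℝ)),
        ∑ n'' ∈ (Icc 1 ⌊x⌋₊).filter (fun n'' : ℕ => x / 2 < (m * n'' : ℝ) ∧ (m * n'' : ℝ) ≤ x),
          ξ m * κ n'' * (w (m * n'') : ℂ) := by
    have hφmul : ∀ (m : ℕ) (z : ℂ),
        φ m * z = if (x / 2) ^ θ < (m : ℝ) ∧ (m : ℝ) ≤ x ^ (θ + ν) then z else 0 := by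
      intro m z; simp only [hφ]; split_ifs <;> simp
    simp_rw [hφmul]
    rw [← Finset.sum_filter]
    apply Finset.sum_subset
    · intro m hm
      rw [Finset.mem_filter, Finset.mem_Icc] at hm
      obtain ⟨⟨h1, _⟩, hlo, hhi⟩ := hm
      rw [Finset.mem_filter, Finset.mem_Icc]
      exact ⟨⟨h1, Nat.le_floor hhi⟩, hlo⟩
    · intro m hm hm'
      rw [Finset.mem_filter, Finset.mem_Icc] at hm
      obtain ⟨⟨h1, hfl⟩, hlo⟩ := hm
      have hmx : x < (m : ℝ) := by
        by_contra hle
        rw [not_lt] at hle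
        apply hm'
        rw [Finset.mem_filter, Finset.mem_Icc]
        refine ⟨⟨h1, Nat.le_floor hle⟩, hlo, ?_⟩
        exact (Nat.cast_le.mpr hfl).trans (Nat.floor_le (Real.rpow_nonneg hx _))
      refine Finset.sum_eq_zero fun n'' hn'' => ?_
      exfalso
      rw [Finset.mem_filter, Finset.mem_Icc] at hn''
      obtain ⟨⟨hn1, _⟩, _, hle⟩ := hn''
      have : (m : ℝ) ≤ (m : ℝ) * (n'' : ℝ) := le_mul_of_one_le_right (Nat.cast_nonneg _) (by exact_mod_cast hn1)
      linarith
  -- assemble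
  rw [Finset.sum_congr rfl fun n _ => k1 n, k3, Finset.sum_congr rfl fun m _ => k5 m, k7]
  exact typeII_apply_tupleCoeff hII (fun i => υ (E.orderEmbOfFin hk i)) (fun i a => hυ _ a)
    (fun i => υ (Eᶜ.orderEmbOfFin hl i)) (fun j a => hυ _ a) hB0 hBk hBl

end Summit.Parity.GeneralizedHardyLittlewood.FordMaynardSieveConst01651SieveConst01651
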